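import Mathlib
import HarnessLib
import Literature.Analysis.FluidPDE.SuitableWeak
import Literature.Analysis.FluidPDE.LocalTypeI
import Literature.Analysis.FluidPDE.SpaceTimeRescaling
import Literature.Analysis.FluidPDE.LocalTypeIScaling
import Literature.Analysis.FluidPDE.LocalTypeICongr
import Literature.Analysis.FluidPDE.LocalTypeIReverseZoom
import Literature.Analysis.FluidPDE.SlabTypeICompactness
import Literature.Analysis.FluidPDE.ClassicalTopPointRegularity
import Literature.Analysis.FunctionSpaces.BesovSliceMeasurability
import Summits.NavierStokesRegularity.NavierStokesRegularity.Theorems.ApexLocalisation.Negative.FinalSlice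

/-!
# `RellichScar.ApexLocalisation`, line `decaying-ancient-bridge`: persistence of singularities at
# moving centres (stub `stub_movingCentrePersistence`)

Albritton–Barker 2019, Prop. 2.3 (persistence of singularities), transported by spatial
translation: if continuous suitable weak slab profiles `(u_k, p_k, G_k)` with `𝐈 ≤ I < ⊤`
converge in `L³(Q(0,R))` for every `R > 0` to a locally integrable field `v`, and
`‖u_k(t_k, x_k)‖ → ∞` with `t_k ↑ 0`, `x_k → x₀`, then `(0, x₀)` is a backward singular point
of `v` (`stub_movingCentrePersistence`).

Proof: the translates `w_k = u_k(·, x_k + ·)` are again in the class (translation covariance,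
`ApexLocalisation.Negative.Translate`), they blow up in `L^∞(Q(0,R))` at their own origin column
(continuity makes the essential supremum a pointwise bound), and they converge in `L³(Q(0,R))` to
`W = v(·, x₀ + ·)` (measure-preserving translation plus continuity of translation in `L³`,
`Literature.Analysis.FunctionSpaces.continuous_eLpNorm_comp_add_sub`).  The slab engine
`slab_typeI_compactness` produces a subsequential `L³_loc` limit singular at the origin; by
uniqueness of `L³` limits it agrees with `W` a.e. on every `Q(0,R)`, so `W` is singular at the
origin, i.e. `v` is singular at `(0, x₀)`.

## References

* D. Albritton, T. Barker, J. Math. Fluid Mech. 21 (2019), Prop. 2.3 and §3. [AlbrittonBarker2019]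
* W. Rudin, *Real and Complex Analysis*, Thm. 9.5 (continuity of translation in `L^p`). [folklore]
-/

set_option linter.dupNamespace false

namespace Summit.NavierStokesRegularity.NavierStokesRegularity.Theorems.RellichScarApexLocalisation

open MeasureTheory Set Function Metric Filter Topology TopologicalSpace
open scoped ENNReal NNReal
open Literature.Analysis Literature.Analysis.FluidPDE
open Summit.NavierStokesRegularity.NavierStokesRegularity.Theorems.ApexLocalisation.Negative.Translate

local notation "E³" => EuclideanSpace ℝ (Fin 3)

/-! ### Spatial translation of space–time: measure preservation and parabolic balls -/

/-- `uncurry` of a spatial translate is the composition with the space–time shift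
`(t, x) ↦ (t, a + x)`. -/
theorem uncurry_translate {F : Type*} (a : E³) (ψ : ℝ → E³ → F) :
    uncurry (translate a ψ) = uncurry ψ ∘ fun z : ℝ × E³ => (z.1, a + z.2) := rfl

/-- The space–time shift is left addition by `(0, a)` in the group `ℝ × ℝ³`. -/
theorem spaceShift_eq_add (a : E³) :
    (fun z : ℝ × E³ => (z.1, a + z.2)) = fun z => (((0 : ℝ), a) : ℝ × E³) + z := by
  funext z
  ext <;> simp

/-- The space–time shift preserves Lebesgue measure. -/
theorem measurePreserving_spaceShift (a : E³) :
    MeasurePreserving (fun z : ℝ × E³ => (z.1, a + z.2)) volume volume := by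
  haveI : (volume : Measure (ℝ × E³)).IsAddLeftInvariant := by
    rw [Measure.volume_eq_prod]; infer_instance
  rw [spaceShift_eq_add]
  exact measurePreserving_add_left volume _

/-- The space–time shift is a measurable embedding. -/
theorem measurableEmbedding_spaceShift (a : E³) :
    MeasurableEmbedding (fun z : ℝ × E³ => (z.1, a + z.2)) := by
  rw [spaceShift_eq_add]
  exact measurableEmbedding_addLeft _

/-- The shift by `a` pulls the parabolic ball `Q((0,a), R)` back to `Q(0, R)`. -/
theorem spaceShift_preimage_parabolicCylinder (a : E³) (R : ℝ) :
    (fun z : ℝ × E³ => (z.1, a + z.2)) ⁻¹' parabolicCylinder R ((0 : ℝ), a) =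
      parabolicCylinder R (0 : ℝ × E³) := by
  ext z
  simp [mem_parabolicCylinder, dist_eq_norm]

/-- The shift fixes the lower half-space `(-∞, 0) × ℝ³`. -/
theorem spaceShift_preimage_lowerHalf (a : E³) :
    (fun z : ℝ × E³ => (z.1, a + z.2)) ⁻¹' (Iio (0 : ℝ) ×ˢ (univ : Set E³)) = Iio (0 : ℝ) ×ˢ univ := by
  ext z
  simp

/-- **`L^p` norms on parabolic balls are translation covariant**:
`‖ψ(·, a + ·)‖_{L^p(Q(0,R))} = ‖ψ‖_{L^p(Q((0,a),R))}`. -/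
theorem eLpNorm_translate_parabolicCylinder {F : Type*} [NormedAddCommGroup F] (a : E³)
    (ψ : ℝ → E³ → F) (p : ℝ≥0∞) (R : ℝ) :
    eLpNorm (uncurry (translate a ψ)) p (volume.restrict (parabolicCylinder R (0 : ℝ × E³))) =
      eLpNorm (uncurry ψ) p (volume.restrict (parabolicCylinder R ((0 : ℝ), a))) := by
  rw [uncurry_translate, ← spaceShift_preimage_parabolicCylinder a R,
    ← (measurableEmbedding_spaceShift a).eLpNorm_map_measure,
    ((measurePreserving_spaceShift a).restrict_preimage
      (isOpen_parabolicCylinder R _).measurableSet).map_eq]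

/-- A.e.-strong measurability on the slab is preserved by spatial translation. -/
theorem aestronglyMeasurable_translate_slab {F : Type*} [TopologicalSpace F] {f : ℝ → E³ → F}
    (hf : AEStronglyMeasurable (uncurry f) (volume.restrict (Iio (0 : ℝ) ×ˢ (univ : Set E³))))
    (a : E³) :
    AEStronglyMeasurable (uncurry (translate a f)) (volume.restrict (Iio (0 : ℝ) ×ˢ (univ : Set E³))) := by
  rw [uncurry_translate]
  conv => arg 2; rw [← spaceShift_preimage_lowerHalf a]
  exact hf.comp_measurePreserving
    ((measurePreserving_spaceShift a).restrict_preimage (measurableSet_Iio.prod MeasurableSet.univ))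

/-- Shifted points of `Q(0,R)` lie in `Q(0,R')` once `R + ‖a‖ ≤ R'`. -/
theorem spaceShift_mem_parabolicCylinder {R R' : ℝ} {a : E³} {z : ℝ × E³} (hR : 0 ≤ R)
    (ha : R + ‖a‖ ≤ R') (hz : z ∈ parabolicCylinder R (0 : ℝ × E³)) :
    (z.1, a + z.2) ∈ parabolicCylinder R' (0 : ℝ × E³) := by
  rw [SuitableCompactness.mem_parabolicCylinder_zero] at hz ⊢
  have hRR' : R ≤ R' := by linarith [norm_nonneg a]
  have h2 : R ^ 2 ≤ R' ^ 2 := pow_le_pow_left₀ hR hRR' 2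
  refine ⟨⟨by linarith [hz.1.1], hz.1.2⟩, ?_⟩
  calc ‖a + z.2‖ ≤ ‖a‖ + ‖z.2‖ := norm_add_le _ _
    _ < ‖a‖ + R := by linarith [hz.2]
    _ ≤ R' := by linarith

/-- The translated ball `Q((0,a),R)` lies in `Q(0,R')` once `R + ‖a‖ ≤ R'`. -/
theorem parabolicCylinder_shift_subset {R R' : ℝ} {a : E³} (hR : 0 ≤ R) (ha : R + ‖a‖ ≤ R') :
    parabolicCylinder R ((0 : ℝ), a) ⊆ parabolicCylinder R' (0 : ℝ × E³) := by
  intro w hw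
  have hz : (w.1, w.2 - a) ∈ parabolicCylinder R (0 : ℝ × E³) := by
    rw [← spaceShift_preimage_parabolicCylinder a R, mem_preimage]
    simpa using hw
  simpa using spaceShift_mem_parabolicCylinder hR ha hz

/-! ### Uniqueness of `L^p` limits -/

/-- Two `L^p` limits of one sequence agree almost everywhere (`1 ≤ p`). -/
theorem ae_eq_of_tendsto_eLpNorm_sub {α F : Type*} [MeasurableSpace α] [NormedAddCommGroup F]
    {μ : Measure α} {p : ℝ≥0∞} (hp : 1 ≤ p) {f : ℕ → α → F} {g h : α → F}
    (hf : ∀ n, AEStronglyMeasurable (f n) μ) (hg : AEStronglyMeasurable g μ)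
    (hh : AEStronglyMeasurable h μ)
    (h1 : Tendsto (fun n => eLpNorm (f n - g) p μ) atTop (𝓝 0))
    (h2 : Tendsto (fun n => eLpNorm (f n - h) p μ) atTop (𝓝 0)) :
    ∀ᵐ x ∂μ, g x = h x := by
  have hle : ∀ n, eLpNorm (g - h) p μ ≤ eLpNorm (f n - g) p μ + eLpNorm (f n - h) p μ := fun n =>
    calc eLpNorm (g - h) p μ = eLpNorm ((g - f n) + (f n - h)) p μ := by rw [sub_add_sub_cancel]
      _ ≤ eLpNorm (g - f n) p μ + eLpNorm (f n - h) p μ :=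
          eLpNorm_add_le (hg.sub (hf n)) ((hf n).sub hh) hp
      _ = eLpNorm (f n - g) p μ + eLpNorm (f n - h) p μ := by rw [eLpNorm_sub_comm]
  have h0 : eLpNorm (g - h) p μ = 0 := by
    refine le_antisymm ?_ zero_le
    have := ge_of_tendsto' (h1.add h2) hle
    simpa using this
  have hp0 : p ≠ 0 := (lt_of_lt_of_le zero_lt_one hp).ne'
  filter_upwards [(eLpNorm_eq_zero_iff (hg.sub hh) hp0).1 h0] with x hx
  exact sub_eq_zero.1 hx

/-! ### `L³_loc` convergence of the translates -/

/-- The `L³_loc` limit of slab fields with finite `L³(Q(0,R))` norms is in `L³(Q(0,R))`. -/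
theorem memLp_limit_parabolicCylinder {uk : ℕ → ℝ → E³ → E³} {v : ℝ → E³ → E³}
    (hm : ∀ k, AEStronglyMeasurable (uncurry (uk k)) (volume.restrict (Iio (0 : ℝ) ×ˢ (univ : Set E³))))
    (hfin : ∀ k (R : ℝ), 0 < R →
      eLpNorm (uncurry (uk k)) 3 (volume.restrict (parabolicCylinder R (0 : ℝ × E³))) < ⊤)
    (hv : AEStronglyMeasurable (uncurry v) (volume.restrict (Iio (0 : ℝ) ×ˢ (univ : Set E³))))
    (hconv : ∀ R : ℝ, 0 < R → Tendsto (fun k => eLpNorm (uncurry (uk k) - uncurry v) 3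
      (volume.restrict (parabolicCylinder R (0 : ℝ × E³)))) atTop (𝓝 0))
    {R : ℝ} (hR : 0 < R) :
    MemLp (uncurry v) 3 (volume.restrict (parabolicCylinder R (0 : ℝ × E³))) := by
  have hsub : parabolicCylinder R (0 : ℝ × E³) ⊆ Iio (0 : ℝ) ×ˢ univ :=
    parabolicCylinder_subset_lowerHalf le_rfl R
  obtain ⟨k, hk⟩ := ((hconv R hR).eventually (gt_mem_nhds zero_lt_one)).exists
  have hmk : AEStronglyMeasurable (uncurry (uk k))
      (volume.restrict (parabolicCylinder R (0 : ℝ × E³))) :=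
    (hm k).mono_measure (Measure.restrict_mono hsub le_rfl)
  have hmv : AEStronglyMeasurable (uncurry v) (volume.restrict (parabolicCylinder R (0 : ℝ × E³))) :=
    hv.mono_measure (Measure.restrict_mono hsub le_rfl)
  have h1 : MemLp (uncurry (uk k)) 3 (volume.restrict (parabolicCylinder R (0 : ℝ × E³))) :=
    ⟨hmk, hfin k R hR⟩
  have h2 : MemLp (uncurry (uk k) - uncurry v) 3 (volume.restrict (parabolicCylinder R (0 : ℝ × E³))) :=
    ⟨hmk.sub hmv, hk.trans ENNReal.one_lt_top⟩
  have e : uncurry v = uncurry (uk k) - (uncurry (uk k) - uncurry v) := by rw [sub_sub_cancel]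
  rw [e]
  exact h1.sub h2

/-- **`L³_loc` convergence of the translates**: if `u_k → v` in `L³(Q(0,R))` for every `R > 0`
and `x_k → x₀`, then `u_k(·, x_k + ·) → v(·, x₀ + ·)` in `L³(Q(0,R))` for every `R > 0`
(measure-preserving translation and continuity of translation in `L³`). -/
theorem tendsto_eLpNorm_translate_sub {uk : ℕ → ℝ → E³ → E³} {v : ℝ → E³ → E³}
    {xk : ℕ → E³} {x₀ : E³}
    (hm : ∀ k, AEStronglyMeasurable (uncurry (uk k)) (volume.restrict (Iio (0 : ℝ) ×ˢ (univ : Set E³))))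
    (hfin : ∀ k (R : ℝ), 0 < R →
      eLpNorm (uncurry (uk k)) 3 (volume.restrict (parabolicCylinder R (0 : ℝ × E³))) < ⊤)
    (hv : AEStronglyMeasurable (uncurry v) (volume.restrict (Iio (0 : ℝ) ×ˢ (univ : Set E³))))
    (hconv : ∀ R : ℝ, 0 < R → Tendsto (fun k => eLpNorm (uncurry (uk k) - uncurry v) 3
      (volume.restrict (parabolicCylinder R (0 : ℝ × E³)))) atTop (𝓝 0))
    (hxk : Tendsto xk atTop (𝓝 x₀)) {R : ℝ} (hR : 0 < R) :
    Tendsto (fun k => eLpNorm (uncurry (translate (xk k) (uk k)) - uncurry (translate x₀ v)) 3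
      (volume.restrict (parabolicCylinder R (0 : ℝ × E³)))) atTop (𝓝 0) := by
  -- a larger ball containing all the translated balls
  set R' : ℝ := R + ‖x₀‖ + 1 with hR'
  have hR'0 : 0 < R' := by rw [hR']; positivity
  have hx₀R' : R + ‖x₀‖ ≤ R' := by rw [hR']; linarith
  set Q : Set (ℝ × E³) := parabolicCylinder R (0 : ℝ × E³) with hQ
  set Q' : Set (ℝ × E³) := parabolicCylinder R' (0 : ℝ × E³) with hQ'
  have hQm : MeasurableSet Q := (isOpen_parabolicCylinder R _).measurableSet
  have hQ'm : MeasurableSet Q' := (isOpen_parabolicCylinder R' _).measurableSet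
  have hQs : Q ⊆ Iio (0 : ℝ) ×ˢ univ := parabolicCylinder_subset_lowerHalf le_rfl R
  -- the global `L³` function `g = 1_{Q'} v` and continuity of its translations
  set g : ℝ × E³ → E³ := Q'.indicator (uncurry v) with hg
  have hgm : MemLp g 3 volume := by
    rw [hg, memLp_indicator_iff_restrict hQ'm]
    exact memLp_limit_parabolicCylinder hm hfin hv hconv hR'0
  haveI : (volume : Measure (ℝ × E³)).IsAddRightInvariant := by
    rw [Measure.volume_eq_prod]; infer_instance
  have hgc := FunctionSpaces.continuous_eLpNorm_comp_add_sub (μ := volume) (p := 3)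
    (by norm_num) (by norm_num) hgm
  set hk : ℕ → ℝ × E³ := fun k => ((0 : ℝ), xk k - x₀) with hhk
  have hhk0 : Tendsto hk atTop (𝓝 0) := by
    have h1 : Tendsto (fun k => xk k - x₀) atTop (𝓝 0) := by
      simpa using hxk.sub_const x₀
    have h2 := (tendsto_const_nhds (x := (0 : ℝ))).prodMk_nhds h1
    show Tendsto hk atTop (𝓝 ((0 : ℝ), (0 : E³)))
    simpa [hhk] using h2
  have hB : Tendsto (fun k => eLpNorm (fun x => g (x + hk k) - g x) 3 volume) atTop (𝓝 0) := by
    have h := (hgc.tendsto 0).comp hhk0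
    simpa [Function.comp_def] using h
  have hA := hconv R' hR'0
  -- eventually `‖x_k - x₀‖ < 1`
  have hev : ∀ᶠ k in atTop, ‖xk k - x₀‖ < 1 := by
    have := (tendsto_iff_norm_sub_tendsto_zero.1 hxk).eventually (gt_mem_nhds zero_lt_one)
    exact this
  refine tendsto_of_tendsto_of_tendsto_of_le_of_le' tendsto_const_nhds
    (by simpa using hA.add hB) (Eventually.of_forall fun _ => zero_le) ?_
  filter_upwards [hev] with k hk1
  have hxkR' : R + ‖xk k‖ ≤ R' := by
    have : ‖xk k‖ ≤ ‖xk k - x₀‖ + ‖x₀‖ := norm_le_norm_sub_add _ _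
    rw [hR']; linarith
  -- measurability of the three translates on `Q`
  have hm1 : AEStronglyMeasurable (uncurry (translate (xk k) (uk k))) (volume.restrict Q) :=
    (aestronglyMeasurable_translate_slab (hm k) (xk k)).mono_measure (Measure.restrict_mono hQs le_rfl)
  have hm2 : AEStronglyMeasurable (uncurry (translate (xk k) v)) (volume.restrict Q) :=
    (aestronglyMeasurable_translate_slab hv (xk k)).mono_measure (Measure.restrict_mono hQs le_rfl)
  have hm3 : AEStronglyMeasurable (uncurry (translate x₀ v)) (volume.restrict Q) :=
    (aestronglyMeasurable_translate_slab hv x₀).mono_measure (Measure.restrict_mono hQs le_rfl)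
  -- first term: translate of `u_k - v`
  have hT1 : eLpNorm (uncurry (translate (xk k) (uk k)) - uncurry (translate (xk k) v)) 3
      (volume.restrict Q) ≤ eLpNorm (uncurry (uk k) - uncurry v) 3 (volume.restrict Q') := by
    have e : uncurry (translate (xk k) (uk k)) - uncurry (translate (xk k) v) =
        uncurry (translate (xk k) (uk k - v)) := rfl
    rw [e, hQ, eLpNorm_translate_parabolicCylinder]
    exact eLpNorm_mono_measure _
      (Measure.restrict_mono (parabolicCylinder_shift_subset hR.le hxkR') le_rfl)
  -- second term: continuity of translation
  have hT2 : eLpNorm (uncurry (translate (xk k) v) - uncurry (translate x₀ v)) 3 (volume.restrict Q) ≤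
      eLpNorm (fun x => g (x + hk k) - g x) 3 volume := by
    have e : eLpNorm (uncurry (translate (xk k) v) - uncurry (translate x₀ v)) 3 (volume.restrict Q) =
        eLpNorm ((fun x => g (x + hk k) - g x) ∘ fun z : ℝ × E³ => (z.1, x₀ + z.2)) 3
          (volume.restrict Q) := by
      refine eLpNorm_congr_ae ?_
      filter_upwards [ae_restrict_mem hQm] with z hz
      have hz1 : (z.1, xk k + z.2) ∈ Q' := spaceShift_mem_parabolicCylinder hR.le hxkR' hz
      have hz2 : (z.1, x₀ + z.2) ∈ Q' := spaceShift_mem_parabolicCylinder hR.le hx₀R' hz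
      have e' : ((z.1, x₀ + z.2) : ℝ × E³) + hk k = (z.1, xk k + z.2) :=
        Prod.ext (by simp [hhk]) (by show x₀ + z.2 + (xk k - x₀) = xk k + z.2; abel)
      simp only [Function.comp_apply, Pi.sub_apply, e', hg, indicator_of_mem hz1, indicator_of_mem hz2]
      rfl
    rw [e]
    refine (eLpNorm_mono_measure _ Measure.restrict_le_self).trans (le_of_eq ?_)
    rw [← (measurableEmbedding_spaceShift x₀).eLpNorm_map_measure,
      (measurePreserving_spaceShift x₀).map_eq]
  -- triangle inequality
  calc eLpNorm (uncurry (translate (xk k) (uk k)) - uncurry (translate x₀ v)) 3 (volume.restrict Q)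
      = eLpNorm ((uncurry (translate (xk k) (uk k)) - uncurry (translate (xk k) v)) +
          (uncurry (translate (xk k) v) - uncurry (translate x₀ v))) 3 (volume.restrict Q) := by
        rw [sub_add_sub_cancel]
    _ ≤ _ := eLpNorm_add_le (hm1.sub hm2) (hm2.sub hm3) (by norm_num)
    _ ≤ eLpNorm (uncurry (uk k) - uncurry v) 3 (volume.restrict Q') +
          eLpNorm (fun x => g (x + hk k) - g x) 3 volume := add_le_add hT1 hT2

/-! ### `L^∞` blow-up of the translates at the origin column -/

/-- The translate of a field continuous on the open slab is continuous on every `Q(0,R)`. -/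
theorem continuousOn_translate_parabolicCylinder {u : ℝ → E³ → E³}
    (hu : ContinuousOn (uncurry u) (Iio (0 : ℝ) ×ˢ univ)) (a : E³) (R : ℝ) :
    ContinuousOn (uncurry (translate a u)) (parabolicCylinder R (0 : ℝ × E³)) := by
  rw [uncurry_translate]
  refine hu.comp (by fun_prop) fun z hz => ?_
  exact ⟨(parabolicCylinder_subset_lowerHalf le_rfl R hz).1, mem_univ _⟩

/-- **`L^∞(Q(0,R))` blow-up of the translates**: if `‖u_k(t_k, x_k)‖ → ∞` with `t_k ↑ 0`, the
translates `u_k(·, x_k + ·)`, continuous on the slab, have `‖·‖_{L^∞(Q(0,R))} → ∞` along every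
subsequence, so the `limsup` is `⊤`. -/
theorem limsup_eLpNorm_top_translate_eq_top {uk : ℕ → ℝ → E³ → E³} {tk : ℕ → ℝ} {xk : ℕ → E³}
    (hcont : ∀ k, ContinuousOn (uncurry (uk k)) (Iio (0 : ℝ) ×ˢ univ))
    (htk : ∀ k, tk k < 0) (htk0 : Tendsto tk atTop (𝓝 0))
    (hblow : Tendsto (fun k => ‖uk k (tk k) (xk k)‖) atTop atTop)
    {σ : ℕ → ℕ} (hσ : StrictMono σ) {R : ℝ} (hR : 0 < R) :
    limsup (fun j => eLpNorm (uncurry (translate (xk (σ j)) (uk (σ j)))) ⊤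
      (volume.restrict (parabolicCylinder R (0 : ℝ × E³)))) atTop = ⊤ := by
  refine Tendsto.limsup_eq ?_
  have h1 : Tendsto (fun j => ‖uk (σ j) (tk (σ j)) (xk (σ j))‖ₑ) atTop (𝓝 ⊤) := by
    have h := ENNReal.tendsto_ofReal_atTop.comp (hblow.comp hσ.tendsto_atTop)
    simpa [Function.comp_def, ofReal_norm] using h
  refine tendsto_nhds_top_mono h1 ?_
  have hev : ∀ᶠ j in atTop, -R ^ 2 < tk (σ j) :=
    (htk0.comp hσ.tendsto_atTop).eventually_const_lt (by nlinarith)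
  filter_upwards [hev] with j hj
  have hmem : ((tk (σ j), (0 : E³)) : ℝ × E³) ∈ parabolicCylinder R (0 : ℝ × E³) := by
    rw [SuitableCompactness.mem_parabolicCylinder_zero]
    exact ⟨⟨hj, htk _⟩, by simpa using hR⟩
  have h := enorm_le_eLpNorm_top_restrict_of_continuousOn (μ := volume)
    (isOpen_parabolicCylinder R _) (continuousOn_translate_parabolicCylinder (hcont (σ j)) (xk (σ j)) R) hmem
  have e : uncurry (translate (xk (σ j)) (uk (σ j))) (tk (σ j), (0 : E³)) =
      uk (σ j) (tk (σ j)) (xk (σ j)) := by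
    show uk (σ j) (tk (σ j)) (xk (σ j) + 0) = _
    rw [add_zero]
  rw [e] at h
  exact h

/-! ### The stub -/

/-- **Moving-centre persistence** (A–B Prop. 2.3 transported by spatial translation; the one
analytic input beyond the engine is the continuity of translation in `L³`): let `(u_k,p_k,G_k)` be
continuous suitable weak slab profiles with `𝐈 ≤ I < ⊤` converging in `L³(Q(0,R))` (every `R > 0`)
to a locally integrable field `v`, and let `(t_k, x_k) → (0, x₀)` with `t_k < 0` and
`‖u_k(t_k, x_k)‖ → ∞`. Then `(0, x₀)` is a backward singular point of `v`. -/
theorem stub_movingCentrePersistence :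
    ∀ (I : ℝ≥0∞) (uk : ℕ → ℝ → E³ → E³) (pk : ℕ → ℝ → E³ → ℝ)
      (Gk : ℕ → ℝ → E³ → E³ →L[ℝ] E³) (v : ℝ → E³ → E³) (tk : ℕ → ℝ) (xk : ℕ → E³) (x₀ : E³),
      I < ⊤ →
      (∀ k, IsSuitableWeakSolutionOn (slab E³ (Iio 0) isOpen_Iio) 1 0 (uk k) (pk k)) →
      (∀ k, HasWeakSpatialGradientOn (slab E³ (Iio 0) isOpen_Iio) (uk k) (Gk k)) →
      (∀ k, typeIBound (Iio (0 : ℝ) ×ˢ univ) (uk k) (pk k) (Gk k) ≤ I) →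
      (∀ k, ContinuousOn (uncurry (uk k)) (Iio (0 : ℝ) ×ˢ univ)) →
      LocallyIntegrableOn (uncurry v) (Iio (0 : ℝ) ×ˢ univ) volume →
      (∀ R : ℝ, 0 < R → Tendsto (fun k => eLpNorm (uncurry (uk k) - uncurry v) 3
        (volume.restrict (parabolicCylinder R (0 : ℝ × E³)))) atTop (𝓝 0)) →
      (∀ k, tk k < 0) → Tendsto tk atTop (𝓝 0) → Tendsto xk atTop (𝓝 x₀) →
      Tendsto (fun k => ‖uk k (tk k) (xk k)‖) atTop atTop →
      IsBackwardSingularPoint v ((0 : ℝ), x₀) := by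
  intro I uk pk Gk v tk xk x₀ hI hsw hwg hbd hcont hv hconv htk htk0 hxk hblow
  -- ## Step 1: the translated sequence is in the class
  set w : ℕ → ℝ → E³ → E³ := fun k => translate (xk k) (uk k) with hw
  have hsw' : ∀ k, IsSuitableWeakSolutionOn (slab E³ (Iio 0) isOpen_Iio) 1 0 (w k)
      (translate (xk k) (pk k)) := fun k => isSuitableWeakSolutionOn_translate (hsw k) (xk k)
  have hwg' : ∀ k, HasWeakSpatialGradientOn (slab E³ (Iio 0) isOpen_Iio) (w k)
      (translate (xk k) (Gk k)) := fun k => hasWeakSpatialGradientOn_translate (hwg k) (xk k)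
  have hbd' : ∀ k, typeIBound (Iio (0 : ℝ) ×ˢ univ) (w k) (translate (xk k) (pk k))
      (translate (xk k) (Gk k)) ≤ I := fun k => by
    rw [hw, typeIBound_translate]
    exact hbd k
  -- ## Step 2: the engine
  obtain ⟨U, P, H, σ, hσ, -, hHU, -, hlim, hpers⟩ :=
    slab_typeI_compactness I w _ _ hI hsw' hwg' hbd'
  -- ## Step 3: the limit is singular at the origin
  have hsingU : IsBackwardSingularPoint U 0 := hpers fun R hR =>
    limsup_eLpNorm_top_translate_eq_top hcont htk htk0 hblow hσ hR
  -- ## Step 4: the translates converge to the translate of `v`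
  have hm : ∀ k, AEStronglyMeasurable (uncurry (uk k))
      (volume.restrict (Iio (0 : ℝ) ×ˢ (univ : Set E³))) := fun k =>
    (hwg k).locallyIntegrableOn.aestronglyMeasurable
  have hfin : ∀ k (R : ℝ), 0 < R →
      eLpNorm (uncurry (uk k)) 3 (volume.restrict (parabolicCylinder R (0 : ℝ × E³))) < ⊤ := by
    intro k R hR
    refine lt_of_le_of_lt (eLpNorm_velocity_slab_le hR (pk k) (Gk k)) ?_
    exact ENNReal.rpow_lt_top_of_nonneg (by norm_num)
      (ENNReal.mul_ne_top (by simp) (ne_top_of_le_ne_top hI.ne (hbd k)))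
  have hW : ∀ R : ℝ, 0 < R → Tendsto (fun k => eLpNorm (uncurry (w k) - uncurry (translate x₀ v)) 3
      (volume.restrict (parabolicCylinder R (0 : ℝ × E³)))) atTop (𝓝 0) := fun R hR =>
    tendsto_eLpNorm_translate_sub hm hfin hv.aestronglyMeasurable hconv hxk hR
  -- ## Step 5: uniqueness of the `L³_loc` limit
  have hae : ∀ R : ℝ, 0 < R → ∀ᵐ z ∂(volume.restrict (parabolicCylinder R (0 : ℝ × E³))),
      uncurry U z = uncurry (translate x₀ v) z := by
    intro R hR
    have hQs : parabolicCylinder R (0 : ℝ × E³) ⊆ Iio (0 : ℝ) ×ˢ univ :=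
      parabolicCylinder_subset_lowerHalf le_rfl R
    refine ae_eq_of_tendsto_eLpNorm_sub (p := 3) (by norm_num) (f := fun j => uncurry (w (σ j)))
      (fun j => (hwg' (σ j)).locallyIntegrableOn.aestronglyMeasurable.mono_measure
        (Measure.restrict_mono hQs le_rfl))
      (hHU.locallyIntegrableOn.aestronglyMeasurable.mono_measure (Measure.restrict_mono hQs le_rfl))
      ((aestronglyMeasurable_translate_slab hv.aestronglyMeasurable x₀).mono_measure
        (Measure.restrict_mono hQs le_rfl))
      (hlim R hR) ((hW R hR).comp hσ.tendsto_atTop)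
  -- ## Conclusion: transport the singularity to `v(·, x₀ + ·)` and back to `v`
  rw [← isBackwardSingularPoint_translate_iff]
  intro r hr
  rw [← eLpNorm_congr_ae (hae r hr)]
  exact hsingU r hr

end Summit.NavierStokesRegularity.NavierStokesRegularity.Theorems.RellichScarApexLocalisation
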